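import Summits.QuantumFields.YangMills.Theorems.BalabanUVNodesN18LocalGaugeTransportCube
import Literature.MathematicalPhysics.QuantumFieldTheory.Balaban1983to89.Node00.Record12BgRowCoClassGauge

/-!
# BalabanUVNodes ∕ node N18 = NE5 — closure-ledger item (iii), (β): **[Balaban1987RG1] (1.12) TRANSPORTED THROUGH THE TRANSPORT OF RECORD, IN def-P11's LETTERS** —
# from run B's local-gauge data on its region over a run-A site set `Z` (`(ι∘U)^{ι∘u} = expI ξ A` on the bonds, `‖A‖ ≤ r`, `‖grad ξ A‖ ≤ t₁` on the stencils, `A` bondwise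
# traceless — Hermitian-ness is derived) to `Sect2.LocalGaugeOn Z (Lξ) t′ (transportRaw F k (blockAvg expMeanLogSU) U)` for every `t′ > r·(1 + 2000ℓ²ξr∕L)`, `t′ > t₁·(1 + 3200ℓ²ξr∕L)`;
# and CLAUSE TO CLAUSE: `Sect2.LocalGaugeOn (bmap⁻¹' Z) ξ t U → Sect2.LocalGaugeOn Z (Lξ) t′ (TU)` under numeric smallness only (`48ℓξt ≤ 1`, `4ℓξt < δ_N`, `2Nξt < π`, `L·t + 3200ℓ²ξt² < L·t′`)
# (Track A, DAG node N18 = `T4OutputRate.NE5` :211; cluster K4 «SpineRates», item K3⁷ `SpineGivenEndpointR13SepCoPH`; WIDTH SEAT pub-ymgap-dag-n18-w3 g2, file 7)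

HONEST FRAMING.  Count-neutral kernel bookkeeping (`--supports stmt-QuantumFields-20544 --as helper`); the re-lettering of file 6 (`…N18LocalGaugeTransportCube`) into
node00-def-P11's clause `Sect2.LocalGaugeOn` (`Node00/Record12BgRowCoClassGauge`: `gaugeU (ι∘u) (ι∘U) b = expI ξ (A b)` on `(regionOfSet Y).bonds`, `‖A b‖ < t`,
`‖grad ξ ν (A(·,μ)) x‖ < t` on `(regionOfSet Y).dpairs`): units of `M_N(ℂ)` vs `SU(N)`-valued fields (`Node00.coe_ιSU`, `Units.val` injective), `expI ξ a = exp((iξ)·a)`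
(`Beta.BackgroundVertices.val_expUnit`), `grad ξ ν f x = ξ⁻¹·(f(x + e_ν) − f x)`; the WITNESSES are file 5's coarse gauge `u′(siteShift x) = g(·)⁻¹·u(emb ·)` and the
potential `Ā(b) := (iLξ)⁻¹·log (TU)^{u′}(b)`.  NE5 is NOT PRINTED and NOT proved; N18 is NOT discharged; `hT₀`∕`hTsp` NOT discharged here (what this gives the knit is the
(1.12) HALF of the `SatisfiesI_III`-transport (T3) of dag-n18-d 21 v1.1 at the REAL background, modulo the radii step law (γ′) `t′ ≤ cB·α₀^A`).

REMARK (for def-P11 ∕ the knit; the LOCATED remark of the drafts is RETIRED).  The clause `Sect2.LocalGaugeOn`'s `∃ A` carries no `𝔤`-valuedness of the potential,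
while the comb gauge `exp(iξλ̄_A)` must be `SU(N)`-valued (print's implicit «`A` with values in `𝔤`», [I] p.262).  Both letters are CONSEQUENCES of the clause at the
smallness used: Hermitian-ness from `U^u ∈ U(N)` and `ξ‖A b‖ ≤ 1∕7` (principal logarithm of a unitary, `star_eq_of_gaugeU_eq_expI`), tracelessness from `det U^u = 1`
and `2Nξ‖A b‖ < π` (Liouville, `trace_eq_zero_of_gaugeU_eq_expI`; the `N`-dependent smallness is SHARP — centre elements `e^{2πi∕N}·1`, `N ≥ 19`, are `1∕3`-close to `1`
with principal logarithm of trace `2πi`).  Hence the headline is literally clause to clause: `localGaugeOn_transportRaw_of_localGaugeOn`.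

WHAT.  `val_gaugeU_ιSU` (the units letter IS the matrix letter; private `val_expI_matA`), ★ `star_eq_of_gaugeU_eq_expI` (the potential of a small local gauge is Hermitian),
★ `trace_eq_zero_of_gaugeU_eq_expI` (… and traceless under `2Nξ‖A‖ < π`), ★★ `localGaugeOn_transportRaw_of_localGaugeData` (the statement in the title, from explicit data
`u, A` with `A` bondwise traceless, thresholds `r` for `‖A‖` and `t₁` for `‖grad ξ A‖`), ★★★ `localGaugeOn_transportRaw_of_localGaugeOn` (CLAUSE TO CLAUSE:
`Sect2.LocalGaugeOn (bmap ⁻¹' Z) ξ t U → Sect2.LocalGaugeOn Z (Lξ) t′ (TU)` for `0 < ξ`, `0 ≤ t`, `48ℓξt ≤ 1`, `4ℓξt < δ_N`, `2Nξt < π`, `L·t + 3200ℓ²ξt² < L·t′`).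
ONE STEP ONLY: the relative slack `3200(d+2)²·Lξt` per step is not summable at print's thresholds `t ∝ ξ⁻¹`; in print (1.12) is re-derived at each scale from the
small-field characteristic functions ((0.24)–(0.25)), not transported along the whole ladder — the (β) induction's radii step law (γ′) stays a hypothesis of the knit.

WHAT THIS IS NOT.  Not (γ′); not the (1.11)∕(1.13)∕(1.14) parts ((1.11) = dag-n18-d m13 ∕ n18-e m11); not (T1)∕(T2)∕orbit-(T3); not the complexified twins; finite tori at fixed
`ε` — not continuum ∕ OS ∕ mass gap ∕ Clay.  0 `def`, 0 `sorry`, standard axioms.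
-/

open scoped BigOperators

namespace YMDAG.N18.AvgPotential

open NormedSpace (exp)
open Literature.MathematicalPhysics.QuantumFieldTheory.Balaban1983to89
open Literature.MathematicalPhysics.QuantumFieldTheory.Balaban1983to89.T4Continuum
open Literature.MathematicalPhysics.QuantumFieldTheory.Balaban1983to89.T4LevelShift
open Literature.MathematicalPhysics.QuantumFieldTheory.Balaban1983to89.BlockAveraging
open Literature.MathematicalPhysics.QuantumFieldTheory.Balaban1983to89.ExpMeanLog (deltaSU expMeanLogSU)
open Literature.MathematicalPhysics.QuantumFieldTheory.Balaban1983to89.MatrixLog (mlog)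
open Literature.MathematicalPhysics.QuantumFieldTheory.Balaban1983to89.BlockAveragingEMLLinearised (combMean)
open Literature.MathematicalPhysics.QuantumFieldTheory.Balaban1983to89.B12RegularSpaces111 (gaugeU expI grad)
open Literature.MathematicalPhysics.QuantumFieldTheory.Balaban1983to89.Node00 (MatA SU ιSU coe_ιSU Sect2.regionOfSet Sect2.LocalGaugeOn)
open Summit.QuantumFields.BalabanUV.T4Continuum.B13Carriers (transportRaw transportRaw_apply)
open YMDAG.N18.TwoRunCubes (ladder standing)

open scoped Matrix.Norms.L2Operator

variable {N : ℕ} [NeZero N] {F : T4Family} {k : ℕ}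

/-! ## §1 The units letters are the matrix letters -/

/-- `(ι∘U)^{ι∘u}(b)`, read in `M_N(ℂ)`, IS the matrix of `U^u(b)` (`ιSU` is a monoid morphism, `coe_ιSU`). [cite: Balaban1987RG1, (1.10) p.262 (bookkeeping)] -/
theorem val_gaugeU_ιSU {P : Params} {i : ℕ} (u : GaugeTransf P i (SU N)) (U : GaugeField P i (SU N)) (b : PBond P i) :
    ((gaugeU (fun x => ιSU N (u x)) (fun b' => ιSU N (U b')) b : (MatA N)ˣ) : MatA N) =
      ((GaugeField.gaugeAct u U b : SU N) : MatA N) := by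
  simp only [gaugeU, GaugeField.gaugeAct, ← map_inv, ← map_mul, coe_ιSU]

omit [NeZero N] in
/-- `expI ξ a`, read in `M_N(ℂ)`, IS `exp((iξ)·a)` (`val_expUnit`; public general twin `B12Lemma4Concrete.val_expI`, not imported to keep the cone small; kept private).
[cite: Balaban1987RG1, (1.12) p.262 (bookkeeping)] -/
private theorem val_expI_matA (ξ : ℝ) (a : MatA N) : ((expI ξ a : (MatA N)ˣ) : MatA N) = exp ((Complex.I * ξ : ℂ) • a) := rfl

/-- **THE POTENTIAL OF A SMALL LOCAL GAUGE IS HERMITIAN** (half of the located remark, as a theorem): if `(ι∘U)^{ι∘u}(b) = expI ξ (A b)` with `0 < ξ`, `ξ‖A b‖ ≤ 1∕7`,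
then `A b` is Hermitian — `iξ·A b` is the principal logarithm of the `SU(N)` matrix `U^u(b)` (`B7BlockAvgLog.mlog_exp`), and the logarithm of a unitary near `1` is
skew-Hermitian (`ExpMeanLog.star_mlog_eq_neg`).  (Tracelessness does NOT follow without an `N`-dependent smallness: centre elements.) [cite: Balaban1987RG1, (1.12) p.262] -/
theorem star_eq_of_gaugeU_eq_expI {P : Params} {i : ℕ} (u : GaugeTransf P i (SU N)) (U : GaugeField P i (SU N)) {A : PBond P i → MatA N} {ξ : ℝ}
    (hξ : 0 < ξ) {b : PBond P i} (he : gaugeU (fun x => ιSU N (u x)) (fun b' => ιSU N (U b')) b = expI ξ (A b)) (hsmall : ξ * ‖A b‖ ≤ 1 / 7) :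
    star (A b) = A b := by
  have hW := congrArg (fun z : (MatA N)ˣ => (z : MatA N)) he
  simp only [val_gaugeU_ιSU, val_expI_matA] at hW
  set X : MatA N := (Complex.I * ξ : ℂ) • A b with hX
  have hnI : ‖(Complex.I * ξ : ℂ)‖ = ξ := by rw [norm_mul, Complex.norm_I, one_mul, Complex.norm_real, Real.norm_of_nonneg hξ.le]
  have hXn : ‖X‖ ≤ 1 / 7 := by rw [hX, norm_smul, hnI]; exact hsmall
  -- the matrix `U^u(b)` is unitary and within `1∕3` of `1`
  have hunit : ((GaugeField.gaugeAct u U b : SU N) : MatA N) ∈ Matrix.unitaryGroup (Fin N) ℂ :=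
    Matrix.specialUnitaryGroup_le_unitaryGroup (GaugeField.gaugeAct u U b).prop
  have hlog2 : ‖X‖ < Real.log 2 := lt_of_le_of_lt hXn (by have := Real.log_two_gt_d9; linarith)
  have hmlog : mlog (exp X) = X := B7BlockAvgLog.mlog_exp hlog2
  have hdist : ‖exp X - 1‖ ≤ 1 / 3 := by
    have h := B7TransferAnalyticMean.norm_exp_sub_one_le_two_mul (hXn.trans (by norm_num))
    linarith
  have hstar : star (mlog (exp X)) = -mlog (exp X) :=
    ExpMeanLog.star_mlog_eq_neg (X := exp X) (by rw [← hW]; exact hunit) hdist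
  have hconj : star (Complex.I * ξ : ℂ) = -(Complex.I * ξ : ℂ) := by
    rw [Complex.star_def, map_mul, Complex.conj_I, Complex.conj_ofReal, neg_mul]
  rw [hmlog, hX, star_smul, hconj, neg_smul, neg_inj] at hstar
  exact smul_right_injective (MatA N) (mul_ne_zero Complex.I_ne_zero (by exact_mod_cast hξ.ne')) hstar

/-- **… AND TRACELESS UNDER AN `N`-DEPENDENT SMALLNESS** (the other half of the located remark): if moreover `N·2ξ‖A b‖ < π`, then `tr A b = 0` —
`e^{tr(iξ·A b)} = det U^u(b) = 1` (Liouville) and `|tr(iξ·A b)| ≤ N·‖log U^u(b)‖ ≤ 2N·ξ‖A b‖ < 2π` (`ExpMeanLog.trace_mlog_eq_zero`).  The smallness cannot be dropped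
(centre elements `e^{2πi∕N}·1 ∈ SU(N)`, `N ≥ 19`). [cite: Balaban1987RG1, (1.12) p.262] -/
theorem trace_eq_zero_of_gaugeU_eq_expI {P : Params} {i : ℕ} (u : GaugeTransf P i (SU N)) (U : GaugeField P i (SU N)) {A : PBond P i → MatA N} {ξ : ℝ}
    (hξ : 0 < ξ) {b : PBond P i} (he : gaugeU (fun x => ιSU N (u x)) (fun b' => ιSU N (U b')) b = expI ξ (A b)) (hsmall : ξ * ‖A b‖ ≤ 1 / 7)
    (hπ : (N : ℝ) * (2 * (ξ * ‖A b‖)) < Real.pi) : Matrix.trace (A b) = 0 := by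
  have hW := congrArg (fun z : (MatA N)ˣ => (z : MatA N)) he
  simp only [val_gaugeU_ιSU, val_expI_matA] at hW
  set X : MatA N := (Complex.I * ξ : ℂ) • A b with hX
  have hnI : ‖(Complex.I * ξ : ℂ)‖ = ξ := by rw [norm_mul, Complex.norm_I, one_mul, Complex.norm_real, Real.norm_of_nonneg hξ.le]
  have hXn' : ‖X‖ = ξ * ‖A b‖ := by rw [hX, norm_smul, hnI]
  have hXn : ‖X‖ ≤ 1 / 7 := hXn' ▸ hsmall
  have hSU : exp X ∈ Matrix.specialUnitaryGroup (Fin N) ℂ := by rw [← hW]; exact (GaugeField.gaugeAct u U b).prop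
  have hlog2 : ‖X‖ < Real.log 2 := lt_of_le_of_lt hXn (by have := Real.log_two_gt_d9; linarith)
  have hmlog : mlog (exp X) = X := B7BlockAvgLog.mlog_exp hlog2
  have hdist2 : ‖exp X - 1‖ ≤ 2 * ‖X‖ := B7TransferAnalyticMean.norm_exp_sub_one_le_two_mul (hXn.trans (by norm_num))
  have hdist : ‖exp X - 1‖ ≤ 1 / 3 := by linarith
  have hπ' : (Fintype.card (Fin N) : ℝ) * ‖exp X - 1‖ < Real.pi := by
    rw [Fintype.card_fin]
    calc (N : ℝ) * ‖exp X - 1‖ ≤ N * (2 * (ξ * ‖A b‖)) := by rw [← hXn']; exact mul_le_mul_of_nonneg_left hdist2 (Nat.cast_nonneg N)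
      _ < Real.pi := hπ
  have htr : (mlog (exp X)).trace = 0 := ExpMeanLog.trace_mlog_eq_zero hSU hdist hπ'
  rw [hmlog, hX, Matrix.trace_smul, smul_eq_zero] at htr
  exact htr.resolve_left (mul_ne_zero Complex.I_ne_zero (by exact_mod_cast hξ.ne'))

/-! ## §2 (1.12) transported through the transport of record, in def-P11's clause -/

/-- ★★ **[Balaban1987RG1] (1.12) ONE RUN UP, AS `Sect2.LocalGaugeOn`.**  Let `Z` be a set of run-A sites and `W := bmap ⁻¹' Z` run B's sites over it
(`bmap x = (siteShift ladder)⁻¹(blockOf x)`, dag-n18-d 19c).  Suppose run B's field `U` has, on `W`, a local gauge `u` and a bondwise TRACELESS potential `A` with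
`(ι∘U)^{ι∘u} = expI ξ A` on the bonds of `regionOfSet W`, `‖A‖ ≤ r` there, `‖grad ξ ν A(·, μ)‖ ≤ t₁` on its stencils (`0 < ξ`, `48ℓξr ≤ 1`, `4ℓξr < δ_N`, `ℓ = (d+2)L`).  Then the
transport of record `TU = transportRaw F k (blockAvg expMeanLogSU) U` satisfies `Sect2.LocalGaugeOn Z (Lξ) t′ (TU)` for every `t′` with `L·r + 2000ℓ²ξr² < L·t′` and
`L·t₁ + 3200ℓ²ξ·r·t₁ < L·t′` — i.e. thresholds `r·(1 + 2000(d+2)²·Lξr)`, `t₁·(1 + 3200(d+2)²·Lξr)`: King's K-row times the summable relative slack of the (β) spec.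
The witnesses: the coarse gauge `x ↦ g(siteShift x)⁻¹·u(emb (siteShift x))` (`g = exp(iξλ̄_A)` the `SU(N)` comb gauge) and `Ā(b) := (iLξ)⁻¹·log (TU)^{u′}(b)`.
[cite: Balaban1987RG1, (1.12) p.262, (0.8)-(0.11) p.253, (0.24)-(0.25) p.257; Balaban1985Averaging, (62)-(63) p.28, (93) p.32, Prop. 3 (123) p.36] -/
theorem localGaugeOn_transportRaw_of_localGaugeData (U : GaugeField (F.P (k + 1)) 0 (SU N)) (u : GaugeTransf (F.P (k + 1)) 0 (SU N))
    (A : PBond (F.P (k + 1)) 0 → MatA N) (Z : Set (Site (F.P k) 0)) {ξ r t₁ t' : ℝ} (hξ : 0 < ξ) (hr : 0 ≤ r) (ht₁ : 0 ≤ t₁)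
    (hAt : ∀ b ∈ (Sect2.regionOfSet (F.P (k + 1)) ((fun x => (siteShift (ladder F k)).symm (blockOf x)) ⁻¹' Z)).bonds, Matrix.trace (A b) = 0)
    (he : ∀ b ∈ (Sect2.regionOfSet (F.P (k + 1)) ((fun x => (siteShift (ladder F k)).symm (blockOf x)) ⁻¹' Z)).bonds,
      gaugeU (fun x => ιSU N (u x)) (fun b' => ιSU N (U b')) b = expI ξ (A b))
    (hA : ∀ b ∈ (Sect2.regionOfSet (F.P (k + 1)) ((fun x => (siteShift (ladder F k)).symm (blockOf x)) ⁻¹' Z)).bonds, ‖A b‖ ≤ r)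
    (hdA : ∀ q ∈ (Sect2.regionOfSet (F.P (k + 1)) ((fun x => (siteShift (ladder F k)).symm (blockOf x)) ⁻¹' Z)).dpairs,
      ‖grad ξ q.2.1 (fun y => A ⟨y, q.2.2⟩) q.1‖ ≤ t₁)
    (h48 : 48 * (((((F.P (k + 1)).d + 2) * (F.P (k + 1)).L : ℕ) : ℝ) * (ξ * r)) ≤ 1)
    (hN : 4 * (((((F.P (k + 1)).d + 2) * (F.P (k + 1)).L : ℕ) : ℝ) * (ξ * r)) < deltaSU (Fin N))
    (h1 : ((F.P (k + 1)).L : ℝ) * r + 2000 * (((((F.P (k + 1)).d + 2) * (F.P (k + 1)).L : ℕ) : ℝ)) ^ 2 * ξ * r ^ 2 < (F.P (k + 1)).L * t')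
    (h2 : ((F.P (k + 1)).L : ℝ) * t₁ + 3200 * (((((F.P (k + 1)).d + 2) * (F.P (k + 1)).L : ℕ) : ℝ)) ^ 2 * ξ * r * t₁ < (F.P (k + 1)).L * t') :
    Sect2.LocalGaugeOn Z ((F.P (k + 1)).L * ξ) t' (transportRaw F k (blockAvg (expMeanLogSU (n := Fin N))) U) := by
  classical
  -- letters
  set W : Set (Site (F.P (k + 1)) 0) := (fun x => (siteShift (ladder F k)).symm (blockOf x)) ⁻¹' Z with hW
  set ℓ : ℝ := (((((F.P (k + 1)).d + 2) * (F.P (k + 1)).L : ℕ) : ℝ)) with hℓ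
  have hL0 : (0 : ℝ) < (F.P (k + 1)).L := by exact_mod_cast (F.P (k + 1)).L_pos
  set ξ' : ℝ := (F.P (k + 1)).L * ξ with hξ'
  have hξ'0 : 0 < ξ' := mul_pos hL0 hξ
  -- the Hermitian traceless cutoff of the potential (values off the region's bonds are never read)
  set A0 : PBond (F.P (k + 1)) 0 → MatA N := fun b => if b ∈ (Sect2.regionOfSet (F.P (k + 1)) W).bonds then A b else 0 with hA0
  have hA0_on : ∀ b ∈ (Sect2.regionOfSet (F.P (k + 1)) W).bonds, A0 b = A b := fun b hb => by simp only [hA0, if_pos hb]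
  -- the potential is Hermitian on the region's bonds (principal logarithm of a unitary): `ξ‖A b‖ ≤ ξr ≤ 1∕96`
  have hℓ1 : (2 : ℝ) ≤ ℓ := by
    rw [hℓ]; exact_mod_cast (show 2 ≤ ((F.P (k + 1)).d + 2) * (F.P (k + 1)).L from
      le_trans (by omega) (Nat.mul_le_mul (le_refl _) (F.P (k + 1)).L_pos))
  have hξr : ξ * r ≤ 1 / 7 := by nlinarith [mul_nonneg hξ.le hr]
  have hAh : ∀ b ∈ (Sect2.regionOfSet (F.P (k + 1)) W).bonds, star (A b) = A b := fun b hb =>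
    star_eq_of_gaugeU_eq_expI u U hξ (he b hb) ((mul_le_mul_of_nonneg_left (hA b hb) hξ.le).trans hξr)
  have hA0h : ∀ b, star (A0 b) = A0 b := by
    intro b; by_cases hb : b ∈ (Sect2.regionOfSet (F.P (k + 1)) W).bonds
    · rw [hA0_on b hb]; exact hAh b hb
    · simp only [hA0, if_neg hb, star_zero]
  have hA0t : ∀ b, Matrix.trace (A0 b) = 0 := by
    intro b; by_cases hb : b ∈ (Sect2.regionOfSet (F.P (k + 1)) W).bonds
    · rw [hA0_on b hb]; exact hAt b hb
    · simp only [hA0, if_neg hb, Matrix.trace_zero]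
  -- run B's letters in the matrix currency of files 5–6
  have hUA : ∀ b ∈ (Sect2.regionOfSet (F.P (k + 1)) W).bonds,
      ((GaugeField.gaugeAct u U b : SU N) : MatA N) = exp ((Complex.I * ξ : ℂ) • A0 b) := by
    intro b hb
    have h := congrArg (fun z : (MatA N)ˣ => (z : MatA N)) (he b hb)
    simp only [val_gaugeU_ιSU, val_expI_matA] at h
    rw [hA0_on b hb]; exact h
  have hA' : ∀ b ∈ (Sect2.regionOfSet (F.P (k + 1)) W).bonds, ‖A0 b‖ ≤ r := fun b hb => by rw [hA0_on b hb]; exact hA b hb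
  have hA₁ : ∀ (x : Site (F.P (k + 1)) 0) (ν' μ' : Fin 4), (x, ν', μ') ∈ (Sect2.regionOfSet (F.P (k + 1)) W).dpairs →
      ‖A0 ⟨x.shift ν', μ'⟩ - A0 ⟨x, μ'⟩‖ ≤ ξ * t₁ := by
    intro x ν' μ' hq
    obtain ⟨h0, hν, hμ, hνμ⟩ := hq
    have hb0 : (⟨x, μ'⟩ : PBond (F.P (k + 1)) 0) ∈ (Sect2.regionOfSet (F.P (k + 1)) W).bonds := ⟨h0, hμ⟩
    have hb1 : (⟨x.shift ν', μ'⟩ : PBond (F.P (k + 1)) 0) ∈ (Sect2.regionOfSet (F.P (k + 1)) W).bonds := ⟨hν, hνμ⟩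
    rw [hA0_on _ hb0, hA0_on _ hb1]
    have h := hdA (x, ν', μ') ⟨h0, hν, hμ, hνμ⟩
    simp only [grad] at h
    rw [norm_smul, norm_inv, Complex.norm_real, Real.norm_of_nonneg hξ.le] at h
    rwa [inv_mul_le_iff₀ hξ] at h
  -- the coarse gauge
  obtain ⟨g, hg⟩ := exists_combGaugeSU (P := F.P (k + 1)) (j := 0) hA0h hA0t ξ
  set uA : GaugeTransf (F.P k) 0 (SU N) := fun x => (g (siteShift (ladder F k) x))⁻¹ * u (emb (siteShift (ladder F k) x)) with huA
  set TU := transportRaw F k (blockAvg (expMeanLogSU (n := Fin N))) U with hTU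
  set Abar : PBond (F.P k) 0 → MatA N := fun b => (Complex.I * ξ' : ℂ)⁻¹ • mlog ((GaugeField.gaugeAct uA TU b : SU N) : MatA N) with hAbar
  have hIξ' : (Complex.I * ξ' : ℂ) ≠ 0 := mul_ne_zero Complex.I_ne_zero (by exact_mod_cast hξ'0.ne')
  have hnI : ‖(Complex.I * ξ' : ℂ)⁻¹‖ = ξ'⁻¹ := by
    rw [norm_inv, norm_mul, Complex.norm_I, one_mul, Complex.norm_real, Real.norm_of_nonneg hξ'0.le]
  refine ⟨uA, Abar, fun b hb => ?_, fun b hb => ?_, fun q hq => ?_⟩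
  · -- the gauge letter: `(ι TU)^{ι uA}(b) = expI ξ' (Ā b)` as units
    obtain ⟨y, μ⟩ := b
    apply Units.ext
    rw [val_gaugeU_ιSU, val_expI_matA, hAbar]
    simp only [smul_smul, mul_inv_cancel₀ hIξ', one_smul]
    exact (coe_transportRaw_gaugeAct_eq_exp_mlog U u hA0h hξ.le hr hg Z hUA hA' h48 hN hb).symm
  · -- the sup letter
    obtain ⟨y, μ⟩ := b
    have h := norm_mlog_transportRaw_gaugeAct_le U u hA0h hξ.le hr hg Z hUA hA' h48 hN hb
    rw [hAbar, norm_smul, hnI, inv_mul_lt_iff₀ hξ'0]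
    refine lt_of_le_of_lt h ?_
    have e : ξ' * t' = ξ * ((F.P (k + 1)).L * t') := by rw [hξ']; ring
    rw [e]
    calc ((F.P (k + 1)).L : ℝ) * ξ * r + 2000 * ℓ ^ 2 * ξ ^ 2 * r ^ 2 = ξ * (((F.P (k + 1)).L : ℝ) * r + 2000 * ℓ ^ 2 * ξ * r ^ 2) := by ring
      _ < ξ * (((F.P (k + 1)).L : ℝ) * t') := mul_lt_mul_of_pos_left h1 hξ
  · -- the coarse-difference (grad) letter at a stencil of `regionOfSet Z`
    obtain ⟨y, ν, μ⟩ := q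
    have h := norm_shift_sub_mlog_transportRaw_gaugeAct_le U u hA0h hξ.le hr (mul_nonneg hξ.le ht₁) hg Z hUA hA' hA₁ h48 hN hq
    simp only [grad]
    rw [hAbar]
    simp only
    rw [← smul_sub, smul_smul, norm_smul, norm_mul, norm_inv, Complex.norm_real, Real.norm_of_nonneg hξ'0.le, hnI, ← mul_inv, inv_mul_lt_iff₀ (mul_pos hξ'0 hξ'0)]
    refine lt_of_le_of_lt h ?_
    have e : ξ' * ξ' * t' = ξ * ξ * ((F.P (k + 1)).L * ((F.P (k + 1)).L * t')) := by rw [hξ']; ring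
    rw [e]
    calc ((F.P (k + 1)).L : ℝ) * ξ * ((F.P (k + 1)).L * (ξ * t₁)) + 3200 * ℓ ^ 2 * ξ ^ 2 * r * ((F.P (k + 1)).L * (ξ * t₁))
        = ξ * ξ * ((F.P (k + 1)).L * (((F.P (k + 1)).L : ℝ) * t₁ + 3200 * ℓ ^ 2 * ξ * r * t₁)) := by ring
      _ < ξ * ξ * ((F.P (k + 1)).L * ((F.P (k + 1)).L * t')) :=
          mul_lt_mul_of_pos_left (mul_lt_mul_of_pos_left h2 hL0) (mul_pos hξ hξ)

/-- ★★★ **[Balaban1987RG1] (1.12) ONE RUN UP, CLAUSE TO CLAUSE — NO SIDE LETTERS.**  def-P11's clause for run B's field on `W = bmap ⁻¹' Z` at unit `ξ` and threshold `t`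
implies def-P11's clause for the transport of record on `Z` at unit `Lξ` and every threshold `t′` with `L·t + 3200ℓ²ξt² < L·t′`, provided `0 < ξ`, `0 ≤ t`, `48ℓξt ≤ 1`,
`4ℓξt < δ_N` and `2Nξt < π` (`ℓ = (d+2)L`): Hermitian-ness and tracelessness of the clause's own potential are CONSEQUENCES of the clause at this smallness
(`star_eq_of_gaugeU_eq_expI`, `trace_eq_zero_of_gaugeU_eq_expI`), so `localGaugeOn_transportRaw_of_localGaugeData` applies to the clause's witnesses with `r = t₁ = t`.
Relative slack `3200(d+2)²·Lξt` per step — summable along the (β) spec's geometric `ξ_k`. [cite: Balaban1987RG1, (1.12) p.262, (0.24)-(0.25) p.257; Balaban1985Averaging, Prop. 3 (123) p.36] -/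
theorem localGaugeOn_transportRaw_of_localGaugeOn (U : GaugeField (F.P (k + 1)) 0 (SU N)) (Z : Set (Site (F.P k) 0)) {ξ t t' : ℝ}
    (h : Sect2.LocalGaugeOn ((fun x => (siteShift (ladder F k)).symm (blockOf x)) ⁻¹' Z) ξ t U) (hξ : 0 < ξ) (ht : 0 ≤ t)
    (h48 : 48 * (((((F.P (k + 1)).d + 2) * (F.P (k + 1)).L : ℕ) : ℝ) * (ξ * t)) ≤ 1)
    (hN : 4 * (((((F.P (k + 1)).d + 2) * (F.P (k + 1)).L : ℕ) : ℝ) * (ξ * t)) < deltaSU (Fin N)) (hπ : (N : ℝ) * (2 * (ξ * t)) < Real.pi)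
    (h1 : ((F.P (k + 1)).L : ℝ) * t + 3200 * (((((F.P (k + 1)).d + 2) * (F.P (k + 1)).L : ℕ) : ℝ)) ^ 2 * ξ * t ^ 2 < (F.P (k + 1)).L * t') :
    Sect2.LocalGaugeOn Z ((F.P (k + 1)).L * ξ) t' (transportRaw F k (blockAvg (expMeanLogSU (n := Fin N))) U) := by
  obtain ⟨u, A, he, hA, hdA⟩ := h
  have hℓ2 : (2 : ℝ) ≤ (((((F.P (k + 1)).d + 2) * (F.P (k + 1)).L : ℕ) : ℝ)) := by
    exact_mod_cast (show 2 ≤ ((F.P (k + 1)).d + 2) * (F.P (k + 1)).L from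
      le_trans (by omega) (Nat.mul_le_mul (le_refl _) (F.P (k + 1)).L_pos))
  have hξt : ξ * t ≤ 1 / 7 := by nlinarith [mul_nonneg hξ.le ht]
  have hsm : ∀ b ∈ (Sect2.regionOfSet (F.P (k + 1)) ((fun x => (siteShift (ladder F k)).symm (blockOf x)) ⁻¹' Z)).bonds, ξ * ‖A b‖ ≤ ξ * t :=
    fun b hb => mul_le_mul_of_nonneg_left (hA b hb).le hξ.le
  have hAt : ∀ b ∈ (Sect2.regionOfSet (F.P (k + 1)) ((fun x => (siteShift (ladder F k)).symm (blockOf x)) ⁻¹' Z)).bonds, Matrix.trace (A b) = 0 :=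
    fun b hb => trace_eq_zero_of_gaugeU_eq_expI u U hξ (he b hb) ((hsm b hb).trans hξt)
      (lt_of_le_of_lt (mul_le_mul_of_nonneg_left (mul_le_mul_of_nonneg_left (hsm b hb) (by norm_num)) (Nat.cast_nonneg N)) hπ)
  have h0 : 0 ≤ (((((F.P (k + 1)).d + 2) * (F.P (k + 1)).L : ℕ) : ℝ)) ^ 2 * ξ * t ^ 2 := by positivity
  refine localGaugeOn_transportRaw_of_localGaugeData U u A Z hξ ht ht hAt he (fun b hb => (hA b hb).le) (fun q hq => (hdA q hq).le) h48 hN ?_ ?_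
  · nlinarith [h1, h0]
  · nlinarith [h1, h0]

end YMDAG.N18.AvgPotential
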